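import Literature.Algebra.EuclideanLattices.LatticePointCounting
import Mathlib.MeasureTheory.Integral.Bochner.Set
import HarnessLib

/-!
# Weighted lattice sums over a domain with Lipschitz boundary

Topic `Literature/Algebra/EuclideanLattices` (geometry of numbers), sequel of
`LatticePointCounting.lean` (Marcus, *Number Fields*, Ch. 6, Lemma 2: `#(Λ ∩ S)` against
`μ(S)/covol Λ` with an error controlled by the cells meeting `frontier S`). Everything in this
file is PROVED.

We run Marcus's cell argument once more, now for a WEIGHTED sum: for a real basis `b` of `E`
(lattice `Λ = span_ℤ b`, half-open cells `ℓ + P`), a bounded measurable `S ⊆ E`, a weight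
`g : E → ℂ` bounded by `M` on `S` and integrable on `S`, and a function `osc` dominating the
oscillation of `g` on every cell contained in `S`,

  `‖∑_{ℓ ∈ Λ ∩ S} g(ℓ) − (1/μ(P)) ∫_S g dμ‖ ≤ 2M · #B + ∑_{ℓ ∈ Λ ∩ S} osc(ℓ)`

where `B` is any finite set containing the lattice points whose cell meets `frontier S`
(`norm_sum_sub_integral_le`), and the covered-frontier form
(`norm_sum_sub_integral_le_of_cover`): if `frontier S` is covered by the closed unit balls centred
at a finite set `Y` then `#B ≤ #Y · μ(B(0, 1 + 2R_b))/μ(P)`.  This is the form in which twisted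
lattice sums `∑_{ℓ ∈ Λ ∩ tX} e(φ(ℓ))` (Hecke, Grössencharakter sums over ideals in a cone) are
compared with `∫_{tX} e(φ)`; for `g = 1`, `osc = 0` it is Lemma 2 again.

## References

* D. A. Marcus, *Number Fields*, 2nd ed., Universitext, Springer 2018, Ch. 6, Lemma 2 and its
  proof, pp. 125–127 (`Marcus2018`) — the cell argument, here with a weight.
* E. Hecke, *Eine neue Art von Zetafunktionen und ihre Beziehungen zur Verteilung der Primzahlen
  II*, Math. Z. 6 (1920), 11–51, §2 (lattice sums of Grössencharaktere). [folklore pointer]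
-/

noncomputable section

open MeasureTheory Module Submodule Bornology Set Metric ZSpan
open scoped Pointwise NNReal ENNReal Topology

namespace Literature.Algebra.EuclideanLattices

variable {E : Type*} [NormedAddCommGroup E] [NormedSpace ℝ E]
variable {ι : Type*} [Fintype ι] (b : Basis ι ℝ E)
variable [MeasurableSpace E] [BorelSpace E] [FiniteDimensional ℝ E]
variable (μ : Measure E) [μ.IsAddHaarMeasure]

omit [MeasurableSpace E] [BorelSpace E] [FiniteDimensional ℝ E] in
/-- The points of `S` not in a cell contained in `S` lie in cells meeting `frontier S`: if
`x ∈ S` and the cell of `x` (base point `ℓ = ⌊x⌋_b`) is not one of the cells `ℓ' + P`,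
`ℓ' ∈ T'`, then `ℓ ∈ B`, provided `T'` contains every lattice point of `S` whose cell lies in `S`
and `B` every lattice point whose cell meets the frontier. [cite: Marcus2018, Ch. 6, proof of Lemma 2] -/
theorem subset_biUnion_cell_union' {S : Set E} {T' B : Finset E}
    (hT' : ∀ ℓ ∈ span ℤ (Set.range b), ℓ ∈ S → cell b ℓ ⊆ S → ℓ ∈ T')
    (hB : ∀ ℓ ∈ span ℤ (Set.range b), (cell b ℓ ∩ frontier S).Nonempty → ℓ ∈ B) :
    S ⊆ (⋃ ℓ ∈ T', cell b ℓ) ∪ ⋃ ℓ ∈ B, cell b ℓ := by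
  intro x hxS
  set ℓ : E := (floor b x : E) with hℓ
  have hℓΛ : ℓ ∈ span ℤ (Set.range b) := (floor b x).2
  have hx : x ∈ cell b ℓ := mem_cell_floor b x
  by_cases hℓS : ℓ ∈ S
  · by_cases hsub : cell b ℓ ⊆ S
    · refine Or.inl ?_
      simp only [mem_iUnion, exists_prop]
      exact ⟨ℓ, hT' ℓ hℓΛ hℓS hsub, hx⟩
    · obtain ⟨y, hy, hyS⟩ := Set.not_subset.1 hsub
      have hfr := cell_inter_frontier_nonempty b hℓΛ ⟨ℓ, self_mem_cell b hℓΛ, hℓS⟩ ⟨y, hy, hyS⟩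
      refine Or.inr ?_
      simp only [mem_iUnion, exists_prop]
      exact ⟨ℓ, hB ℓ hℓΛ hfr, hx⟩
  · have hfr := cell_inter_frontier_nonempty b hℓΛ ⟨x, hx, hxS⟩ ⟨ℓ, self_mem_cell b hℓΛ, hℓS⟩
    refine Or.inr ?_
    simp only [mem_iUnion, exists_prop]
    exact ⟨ℓ, hB ℓ hℓΛ hfr, hx⟩

/-- **Weighted cell estimate** (Marcus's proof of Lemma 2 run with a weight): for `S` bounded and
measurable, `T` the lattice points of `S`, `B ⊇` the lattice points whose cell meets
`frontier S`, `g` integrable on `S` with `‖g‖ ≤ M` on `S`, and `osc ℓ ≥ 0` bounding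
`‖g x − g ℓ‖` on every cell `ℓ + P ⊆ S`,
`‖(∑_{ℓ ∈ T} g ℓ) μ(P) − ∫_S g dμ‖ ≤ (2 M #B + ∑_{ℓ ∈ T} osc ℓ) μ(P)`.
[cite: Marcus2018, Ch. 6, proof of Lemma 2] -/
theorem norm_sum_mul_sub_integral_le {S : Set E} (hS₁ : IsBounded S) (hS₂ : MeasurableSet S)
    {T : Finset E} (hT : ∀ ℓ, ℓ ∈ T ↔ ℓ ∈ S ∧ ℓ ∈ span ℤ (Set.range b))
    {B : Finset E} (hB : ∀ ℓ ∈ span ℤ (Set.range b), (cell b ℓ ∩ frontier S).Nonempty → ℓ ∈ B)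
    {g : E → ℂ} (hgi : IntegrableOn g S μ) {M : ℝ} (hM : 0 ≤ M) (hg : ∀ x ∈ S, ‖g x‖ ≤ M)
    {osc : E → ℝ} (hosc0 : ∀ ℓ ∈ T, 0 ≤ osc ℓ)
    (hosc : ∀ ℓ ∈ T, cell b ℓ ⊆ S → ∀ x ∈ cell b ℓ, ‖g x - g ℓ‖ ≤ osc ℓ) :
    ‖(∑ ℓ ∈ T, g ℓ) * μ.real (fundamentalDomain b) - ∫ x in S, g x ∂μ‖ ≤
      (2 * M * B.card + ∑ ℓ ∈ T, osc ℓ) * μ.real (fundamentalDomain b) := by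
  classical
  set Λ : Submodule ℤ E := span ℤ (Set.range b) with hΛ
  set P := fundamentalDomain b with hP
  have hPpos : 0 < μ.real P := measureReal_fundamentalDomain_pos b μ
  have hPtop : μ P ≠ ⊤ := (measure_fundamentalDomain_lt_top b μ).ne
  -- the good lattice points: cells inside `S`
  set T' : Finset E := T.filter fun ℓ ↦ cell b ℓ ⊆ S with hT'def
  set T'' : Finset E := T.filter fun ℓ ↦ ¬ cell b ℓ ⊆ S with hT''def
  have hT'mem : ∀ ℓ, ℓ ∈ T' ↔ ℓ ∈ T ∧ cell b ℓ ⊆ S := fun ℓ ↦ by rw [hT'def, Finset.mem_filter]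
  have hT''mem : ∀ ℓ, ℓ ∈ T'' ↔ ℓ ∈ T ∧ ¬ cell b ℓ ⊆ S := fun ℓ ↦ by
    rw [hT''def, Finset.mem_filter]
  have hTsplit : ∀ f : E → ℂ, ∑ ℓ ∈ T, f ℓ = ∑ ℓ ∈ T', f ℓ + ∑ ℓ ∈ T'', f ℓ := fun f ↦
    (Finset.sum_filter_add_sum_filter_not T (fun ℓ ↦ cell b ℓ ⊆ S) f).symm
  have hTsplitR : ∀ f : E → ℝ, ∑ ℓ ∈ T, f ℓ = ∑ ℓ ∈ T', f ℓ + ∑ ℓ ∈ T'', f ℓ := fun f ↦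
    (Finset.sum_filter_add_sum_filter_not T (fun ℓ ↦ cell b ℓ ⊆ S) f).symm
  -- `T'' ⊆ B`
  have hT''B : T'' ⊆ B := by
    intro ℓ hℓ
    obtain ⟨hℓT, hsub⟩ := (hT''mem ℓ).1 hℓ
    obtain ⟨hℓS, hℓΛ⟩ := (hT ℓ).1 hℓT
    obtain ⟨y, hy, hyS⟩ := Set.not_subset.1 hsub
    exact hB ℓ hℓΛ (cell_inter_frontier_nonempty b hℓΛ ⟨ℓ, self_mem_cell b hℓΛ, hℓS⟩ ⟨y, hy, hyS⟩)
  -- the union `A'` of the good cells and its complement in `S`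
  set A' : Set E := ⋃ ℓ ∈ T', cell b ℓ with hA'
  have hA'S : A' ⊆ S := Set.iUnion₂_subset fun ℓ hℓ ↦ ((hT'mem ℓ).1 hℓ).2
  have hA'meas : MeasurableSet A' :=
    MeasurableSet.biUnion T'.countable_toSet fun ℓ hℓ ↦
      measurableSet_cell b ((hT ℓ).1 ((hT'mem ℓ).1 hℓ).1).2
  set Bs : Set E := ⋃ ℓ ∈ B.filter (· ∈ Λ), cell b ℓ with hBs
  have hBmemΛ : ∀ ℓ ∈ B.filter (· ∈ Λ), ℓ ∈ Λ := fun ℓ hℓ ↦ (Finset.mem_filter.1 hℓ).2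
  have hdiff : S \ A' ⊆ Bs := by
    intro x ⟨hxS, hxA⟩
    have hB' : ∀ ℓ ∈ span ℤ (Set.range b), (cell b ℓ ∩ frontier S).Nonempty →
        ℓ ∈ B.filter (· ∈ Λ) := fun ℓ hℓ h ↦ Finset.mem_filter.2 ⟨hB ℓ hℓ h, hℓ⟩
    have hcov := subset_biUnion_cell_union' b (T' := T') (B := B.filter (· ∈ Λ))
      (fun ℓ hℓ hℓS hsub ↦ (hT'mem ℓ).2 ⟨(hT ℓ).2 ⟨hℓS, hℓ⟩, hsub⟩) hB' hxS
    rcases hcov with h | h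
    · exact absurd h hxA
    · exact h
  have hμBs : μ Bs = (B.filter (· ∈ Λ)).card * μ P := measure_biUnion_cell b μ hBmemΛ
  have hμdiff : μ.real (S \ A') ≤ B.card * μ.real P := by
    have h1 : μ (S \ A') ≤ (B.filter (· ∈ Λ)).card * μ P := (measure_mono hdiff).trans hμBs.le
    have h2 : ((B.filter (· ∈ Λ)).card : ℝ≥0∞) * μ P ≤ (B.card : ℝ≥0∞) * μ P := by
      gcongr
      exact Finset.filter_subset _ _
    have h3 := ENNReal.toReal_mono (ENNReal.mul_ne_top (by simp) hPtop) (h1.trans h2)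
    rw [ENNReal.toReal_mul, ENNReal.toReal_natCast] at h3
    simpa [measureReal_def] using h3
  -- decomposition of the integral
  have hint_split : ∫ x in S, g x ∂μ = (∫ x in A', g x ∂μ) + ∫ x in S \ A', g x ∂μ := by
    have hdisj : Disjoint A' (S \ A') := Set.disjoint_sdiff_right
    have hunion : A' ∪ (S \ A') = S := Set.union_sdiff_cancel hA'S
    rw [← setIntegral_union hdisj (hS₂.diff hA'meas) (hgi.mono_set hA'S)
      (hgi.mono_set Set.sdiff_subset), hunion]
  have hint_A' : ∫ x in A', g x ∂μ = ∑ ℓ ∈ T', ∫ x in cell b ℓ, g x ∂μ := by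
    rw [hA']
    refine integral_biUnion_finset T' (fun ℓ hℓ ↦
      measurableSet_cell b ((hT ℓ).1 ((hT'mem ℓ).1 hℓ).1).2) ?_ ?_
    · intro ℓ _ ℓ' _ hne
      exact disjoint_cell b hne
    · intro ℓ hℓ
      exact hgi.mono_set ((hT'mem ℓ).1 (Finset.mem_coe.1 hℓ)).2
  -- the three error terms
  -- (1) the frontier part of the integral
  have e1 : ‖∫ x in S \ A', g x ∂μ‖ ≤ M * (B.card * μ.real P) := by
    have hbd : ∀ᵐ x ∂μ.restrict (S \ A'), ‖g x‖ ≤ M := by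
      filter_upwards [ae_restrict_mem (hS₂.diff hA'meas)] with x hx using hg x hx.1
    calc ‖∫ x in S \ A', g x ∂μ‖ ≤ M * μ.real (S \ A') :=
          norm_setIntegral_le_of_norm_le_const (hS₁.subset Set.sdiff_subset).measure_lt_top
            (fun x hx ↦ hg x hx.1)
      _ ≤ M * (B.card * μ.real P) := mul_le_mul_of_nonneg_left hμdiff hM
  -- (2) the frontier part of the sum
  have e2 : ‖∑ ℓ ∈ T'', g ℓ * μ.real P‖ ≤ M * (B.card * μ.real P) := by
    calc ‖∑ ℓ ∈ T'', g ℓ * μ.real P‖ ≤ ∑ ℓ ∈ T'', ‖g ℓ * μ.real P‖ := norm_sum_le _ _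
      _ ≤ ∑ ℓ ∈ T'', M * μ.real P := by
          refine Finset.sum_le_sum fun ℓ hℓ ↦ ?_
          rw [norm_mul, Complex.norm_real, Real.norm_of_nonneg hPpos.le]
          exact mul_le_mul_of_nonneg_right (hg ℓ ((hT ℓ).1 ((hT''mem ℓ).1 hℓ).1).1) hPpos.le
      _ = T''.card * (M * μ.real P) := by rw [Finset.sum_const, nsmul_eq_mul]
      _ ≤ B.card * (M * μ.real P) := by
          gcongr
      _ = M * (B.card * μ.real P) := by ring
  -- (3) the oscillation on the good cells
  have e3 : ‖∑ ℓ ∈ T', (g ℓ * μ.real P - ∫ x in cell b ℓ, g x ∂μ)‖ ≤ (∑ ℓ ∈ T, osc ℓ) * μ.real P := by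
    have hcell : ∀ ℓ ∈ T', ‖g ℓ * μ.real P - ∫ x in cell b ℓ, g x ∂μ‖ ≤ osc ℓ * μ.real P := by
      intro ℓ hℓ
      obtain ⟨hℓT, hsub⟩ := (hT'mem ℓ).1 hℓ
      have hℓΛ : ℓ ∈ Λ := ((hT ℓ).1 hℓT).2
      have hmeas : MeasurableSet (cell b ℓ) := measurableSet_cell b hℓΛ
      have hμc : μ.real (cell b ℓ) = μ.real P := by
        rw [measureReal_def, measure_cell b μ hℓΛ, measureReal_def]
      have hfin : μ (cell b ℓ) < ⊤ := by rw [measure_cell b μ hℓΛ]; exact lt_top_iff_ne_top.2 hPtop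
      have hconst : ∫ _ in cell b ℓ, g ℓ ∂μ = g ℓ * μ.real P := by
        rw [setIntegral_const, hμc, Complex.real_smul, mul_comm]
      have hgi' : IntegrableOn g (cell b ℓ) μ := hgi.mono_set hsub
      rw [← hconst, ← integral_sub (integrableOn_const (C := g ℓ) hfin.ne (by simp)) hgi']
      have hbd : ∀ x ∈ cell b ℓ, ‖g ℓ - g x‖ ≤ osc ℓ := fun x hx ↦ by
        rw [norm_sub_rev]; exact hosc ℓ hℓT hsub x hx
      calc ‖∫ x in cell b ℓ, (g ℓ - g x) ∂μ‖ ≤ osc ℓ * μ.real (cell b ℓ) :=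
            norm_setIntegral_le_of_norm_le_const hfin hbd
        _ = osc ℓ * μ.real P := by rw [hμc]
    calc ‖∑ ℓ ∈ T', (g ℓ * μ.real P - ∫ x in cell b ℓ, g x ∂μ)‖
        ≤ ∑ ℓ ∈ T', ‖g ℓ * μ.real P - ∫ x in cell b ℓ, g x ∂μ‖ := norm_sum_le _ _
      _ ≤ ∑ ℓ ∈ T', osc ℓ * μ.real P := Finset.sum_le_sum hcell
      _ = (∑ ℓ ∈ T', osc ℓ) * μ.real P := by rw [Finset.sum_mul]
      _ ≤ (∑ ℓ ∈ T, osc ℓ) * μ.real P := by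
          refine mul_le_mul_of_nonneg_right ?_ hPpos.le
          rw [hTsplitR]
          have : 0 ≤ ∑ ℓ ∈ T'', osc ℓ :=
            Finset.sum_nonneg fun ℓ hℓ ↦ hosc0 ℓ ((hT''mem ℓ).1 hℓ).1
          linarith
  -- assemble
  have hdecomp : (∑ ℓ ∈ T, g ℓ) * μ.real P - ∫ x in S, g x ∂μ =
      ∑ ℓ ∈ T', (g ℓ * μ.real P - ∫ x in cell b ℓ, g x ∂μ) + ∑ ℓ ∈ T'', g ℓ * μ.real P -
        ∫ x in S \ A', g x ∂μ := by
    rw [hint_split, hint_A', Finset.sum_mul, hTsplit, Finset.sum_sub_distrib]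
    ring
  rw [hdecomp]
  calc ‖∑ ℓ ∈ T', (g ℓ * μ.real P - ∫ x in cell b ℓ, g x ∂μ) + ∑ ℓ ∈ T'', g ℓ * μ.real P -
          ∫ x in S \ A', g x ∂μ‖
      ≤ ‖∑ ℓ ∈ T', (g ℓ * μ.real P - ∫ x in cell b ℓ, g x ∂μ)‖ + ‖∑ ℓ ∈ T'', g ℓ * μ.real P‖ +
          ‖∫ x in S \ A', g x ∂μ‖ := norm_sub_le_of_le (norm_add_le _ _) le_rfl
    _ ≤ (∑ ℓ ∈ T, osc ℓ) * μ.real P + M * (B.card * μ.real P) + M * (B.card * μ.real P) := by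
          linarith [e1, e2, e3]
    _ = (2 * M * B.card + ∑ ℓ ∈ T, osc ℓ) * μ.real P := by ring

/-- **Weighted lattice sums with a covered frontier**: for `S` bounded and measurable whose
frontier is covered by the closed unit balls centred at a finite set `Y`, `T = Λ ∩ S`, `g`
integrable on `S` with `‖g‖ ≤ M` there, and `osc ℓ ≥ 0` bounding `‖g x − g ℓ‖` on every cell
`ℓ + P ⊆ S`,
`‖∑_{ℓ ∈ T} g ℓ − (1/μ(P)) ∫_S g dμ‖ ≤ 2M · #Y · μ(B(0, 1 + 2R_b))/μ(P) + ∑_{ℓ ∈ T} osc ℓ`.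
For `g = 1`, `osc = 0` this is `LatticePointCounting.abs_card_sub_div_le_of_cover`.
[cite: Marcus2018, Ch. 6, Lemma 2 (weighted form of the proof)] -/
theorem norm_sum_sub_integral_le_of_cover {S : Set E} (hS₁ : IsBounded S) (hS₂ : MeasurableSet S)
    {T : Finset E} (hT : ∀ ℓ, ℓ ∈ T ↔ ℓ ∈ S ∧ ℓ ∈ span ℤ (Set.range b))
    {Y : Finset E} (hY : frontier S ⊆ ⋃ y ∈ Y, closedBall y 1)
    {g : E → ℂ} (hgi : IntegrableOn g S μ) {M : ℝ} (hM : 0 ≤ M) (hg : ∀ x ∈ S, ‖g x‖ ≤ M)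
    {osc : E → ℝ} (hosc0 : ∀ ℓ ∈ T, 0 ≤ osc ℓ)
    (hosc : ∀ ℓ ∈ T, cell b ℓ ⊆ S → ∀ x ∈ cell b ℓ, ‖g x - g ℓ‖ ≤ osc ℓ) :
    ‖(∑ ℓ ∈ T, g ℓ) - (μ.real (fundamentalDomain b))⁻¹ * ∫ x in S, g x ∂μ‖ ≤
      2 * M * (Y.card * (μ.real (closedBall (0 : E) (1 + 2 * cellRadius b)) /
        μ.real (fundamentalDomain b))) + ∑ ℓ ∈ T, osc ℓ := by
  classical
  set Λ : Submodule ℤ E := span ℤ (Set.range b) with hΛ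
  have hPpos := measureReal_fundamentalDomain_pos b μ
  -- the lattice points whose cell meets the frontier form a finite set
  have hfrb : IsBounded (frontier S) := hS₁.closure.subset frontier_subset_closure
  obtain ⟨R₀, hR₀⟩ := hfrb.subset_closedBall 0
  have hfin : {ℓ : E | ℓ ∈ Λ ∧ (cell b ℓ ∩ frontier S).Nonempty}.Finite := by
    refine (setFinite_inter b (isBounded_closedBall (x := (0 : E))
      (r := R₀ + cellRadius b))).subset ?_
    rintro ℓ ⟨hℓ, x, hx, hxf⟩
    refine ⟨?_, hℓ⟩
    have h1 := norm_sub_le_of_mem_cell b hx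
    have h2 : ‖x‖ ≤ R₀ := by simpa using hR₀ hxf
    rw [mem_closedBall, dist_zero_right]
    calc ‖ℓ‖ = ‖x - (x - ℓ)‖ := by abel_nf
      _ ≤ ‖x‖ + ‖x - ℓ‖ := norm_sub_le _ _
      _ ≤ R₀ + cellRadius b := add_le_add h2 h1
  set B : Finset E := hfin.toFinset with hBdef
  have hBmem : ∀ ℓ, ℓ ∈ B ↔ ℓ ∈ Λ ∧ (cell b ℓ ∩ frontier S).Nonempty := fun ℓ ↦ by
    rw [hBdef, Set.Finite.mem_toFinset]; rfl
  have hB : ∀ ℓ ∈ Λ, (cell b ℓ ∩ frontier S).Nonempty → ℓ ∈ B := fun ℓ hℓ h ↦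
    (hBmem ℓ).2 ⟨hℓ, h⟩
  have hmain := norm_sum_mul_sub_integral_le b μ hS₁ hS₂ hT hB hgi hM hg hosc0 hosc
  -- bound `#B` using the cover (as in `abs_card_sub_div_le_of_cover`)
  have hBle : (B.card : ℝ) ≤ Y.card * (μ.real (closedBall (0 : E) (1 + 2 * cellRadius b)) /
      μ.real (fundamentalDomain b)) := by
    set By : E → Finset E := fun y ↦ B.filter fun ℓ ↦ (cell b ℓ ∩ closedBall y 1).Nonempty
      with hBy
    have hcov : B ⊆ Y.biUnion By := by
      intro ℓ hℓ
      obtain ⟨hℓΛ, x, hx, hxf⟩ := (hBmem ℓ).1 hℓ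
      have := hY hxf
      simp only [mem_iUnion, exists_prop] at this
      obtain ⟨y, hy, hxy⟩ := this
      rw [Finset.mem_biUnion]
      exact ⟨y, hy, Finset.mem_filter.2 ⟨hℓ, x, hx, hxy⟩⟩
    have hcard := (Finset.card_le_card hcov).trans Finset.card_biUnion_le
    have heach : ∀ y ∈ Y, ((By y).card : ℝ) ≤
        μ.real (closedBall (0 : E) (1 + 2 * cellRadius b)) / μ.real (fundamentalDomain b) :=
      fun y _ ↦ card_le_of_cell_inter_closedBall b μ
        (fun ℓ hℓ ↦ ((hBmem ℓ).1 (Finset.mem_filter.1 hℓ).1).1)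
        (fun ℓ hℓ ↦ (Finset.mem_filter.1 hℓ).2)
    calc (B.card : ℝ) ≤ ∑ y ∈ Y, ((By y).card : ℝ) := by exact_mod_cast hcard
      _ ≤ ∑ y ∈ Y, μ.real (closedBall (0 : E) (1 + 2 * cellRadius b)) /
            μ.real (fundamentalDomain b) := Finset.sum_le_sum heach
      _ = _ := by rw [Finset.sum_const, nsmul_eq_mul]
  have key : ‖(∑ ℓ ∈ T, g ℓ) - (μ.real (fundamentalDomain b))⁻¹ * ∫ x in S, g x ∂μ‖ ≤
      2 * M * B.card + ∑ ℓ ∈ T, osc ℓ := by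
    have hne : ((μ.real (fundamentalDomain b) : ℝ) : ℂ) ≠ 0 := by
      exact_mod_cast hPpos.ne'
    have hrw : (∑ ℓ ∈ T, g ℓ) - (((μ.real (fundamentalDomain b))⁻¹ : ℝ) : ℂ) * ∫ x in S, g x ∂μ =
        ((μ.real (fundamentalDomain b) : ℂ))⁻¹ *
          ((∑ ℓ ∈ T, g ℓ) * μ.real (fundamentalDomain b) - ∫ x in S, g x ∂μ) := by
      rw [Complex.ofReal_inv, mul_sub, mul_comm (∑ ℓ ∈ T, g ℓ) _, ← mul_assoc,
        inv_mul_cancel₀ hne, one_mul]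
    rw [hrw, norm_mul, norm_inv, Complex.norm_real, Real.norm_of_nonneg hPpos.le,
      inv_mul_le_iff₀ hPpos]
    calc ‖(∑ ℓ ∈ T, g ℓ) * μ.real (fundamentalDomain b) - ∫ x in S, g x ∂μ‖
        ≤ (2 * M * B.card + ∑ ℓ ∈ T, osc ℓ) * μ.real (fundamentalDomain b) := hmain
      _ = μ.real (fundamentalDomain b) * (2 * M * B.card + ∑ ℓ ∈ T, osc ℓ) := by ring
  calc _ ≤ 2 * M * B.card + ∑ ℓ ∈ T, osc ℓ := key
    _ ≤ 2 * M * (Y.card * (μ.real (closedBall (0 : E) (1 + 2 * cellRadius b)) /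
        μ.real (fundamentalDomain b))) + ∑ ℓ ∈ T, osc ℓ := by
        have := mul_le_mul_of_nonneg_left hBle (by positivity : (0 : ℝ) ≤ 2 * M)
        linarith

end Literature.Algebra.EuclideanLattices

end
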